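import Summits.KontsevichZagierPeriods.KontsevichZagierPeriods.Theorems.AbelContractionRealHyperellipticSectorDefs

/-!
# Route AbelContraction — `RealHyperellipticSector` (crux stmt-KontsevichZagierPeriods-12475): factoring an M-polynomial

Helper file of the line `Lines/birth.lean` (registered bricks `engine_mPoly_factor` and
`engine_prod_range_even_odd` of the stub `stub_engine`, `--supports` the crux). Two algebra steps
of the separating pencil `q = lc · N · D` (`N = ∏ₖ (x − e (2k))`, `D = ∏ₖ (x − e (2k+1))`) of an
M-polynomial `q ∈ ℚ[X]`:

* `engine_mPoly_factor`: if `q ∈ ℚ[X]` has `natDegree q = n` and its real roots are exactly the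
  `n` numbers `e 0 < e 1 < ⋯ < e (n − 1)`, then `q(t) = lc · ∏_{i < n} (t − e i)` for every real `t`
  (`lc` the leading coefficient): the `n` distinct roots exhaust the `≤ n` roots of `q` over `ℝ`
  counted with multiplicity (`Polynomial.card_roots'`,
  `Polynomial.C_leadingCoeff_mul_prod_multiset_X_sub_C`).
* `engine_prod_range_even_odd`: the parity split `∏_{i < 2n} f i = (∏_{k < n} f (2k)) · ∏_{k < n} f (2k+1)`.

References: M. Kontsevich, D. Zagier, *Periods* (2001), §1.2 [KontsevichZagier2001];
B. Gross, J. Harris, *Real algebraic curves*, Ann. Sci. ÉNS 14 (1981), §3 [GrossHarris1981].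
No definitions are introduced.
-/

noncomputable section

open Set
open scoped Polynomial
open Literature.NumberTheory.Transcendental

namespace Summit.KontsevichZagierPeriods.AbelContraction.RealHyperellipticSector

/-- **A real M-polynomial factors through its listed real roots**: if `q ∈ ℚ[X]` has
`natDegree q = n` and its real roots are exactly `e 0 < e 1 < ⋯ < e (n − 1)` (`e` strictly
monotone), then `q(t) = lc · ∏_{i < n} (t − e i)` for every real `t` (`lc` the leading coefficient):
the `n` distinct roots exhaust the `≤ n` roots of `q` over `ℝ`, counted with multiplicity. (For
`q = 0` both sides vanish.) [folklore] -/
theorem engine_mPoly_factor : ∀ (q : Polynomial ℚ) (n : ℕ) (e : ℕ → ℝ), q.natDegree = n →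
    StrictMono e → (∀ t : ℝ, Polynomial.aeval t q = 0 ↔ ∃ i < n, t = e i) → ∀ t : ℝ,
    Polynomial.aeval t q = (q.leadingCoeff : ℝ) * ∏ i ∈ Finset.range n, (t - e i) := by
  intro q n e hdeg he hroot t
  rcases eq_or_ne q 0 with rfl | hq0
  · simp
  obtain ⟨qR, hqR⟩ : ∃ qR : ℝ[X], qR = q.map (algebraMap ℚ ℝ) := ⟨_, rfl⟩
  have hqR0 : qR ≠ 0 := hqR ▸ Polynomial.map_ne_zero hq0
  have hdegR : qR.natDegree = n := by rw [hqR, Polynomial.natDegree_map, hdeg]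
  have hlc : qR.leadingCoeff = (q.leadingCoeff : ℝ) := by
    rw [hqR, Polynomial.leadingCoeff_map, eq_ratCast]
  have heval : ∀ s : ℝ, qR.eval s = Polynomial.aeval s q := fun s => by
    rw [hqR, Polynomial.eval_map_algebraMap]
  have hmem : ∀ i, i < n → e i ∈ qR.roots := fun i hi => by
    rw [Polynomial.mem_roots hqR0, Polynomial.IsRoot.def, heval]
    exact (hroot _).mpr ⟨i, hi, rfl⟩
  -- the `n` listed roots, as a multiset, exhaust the roots of `qR`
  obtain ⟨S, hS⟩ : ∃ S : Multiset ℝ, S = (Finset.range n).val.map e := ⟨_, rfl⟩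
  have hSnd : S.Nodup := hS ▸ (Finset.range n).nodup.map he.injective
  have hScard : Multiset.card S = n := by rw [hS, Multiset.card_map, Finset.card_val,
    Finset.card_range]
  have hle : S ≤ qR.roots := by
    refine (Multiset.le_iff_subset hSnd).mpr fun a ha => ?_
    rw [hS, Multiset.mem_map] at ha
    obtain ⟨i, hi, rfl⟩ := ha
    exact hmem i (Finset.mem_range.mp (Finset.mem_val.mp hi))
  have hcard : Multiset.card qR.roots = qR.natDegree := by
    refine le_antisymm (Polynomial.card_roots' qR) ?_
    rw [hdegR, ← hScard]
    exact Multiset.card_le_card hle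
  have hSeq : S = qR.roots :=
    Multiset.eq_of_le_of_card_le hle (by rw [hcard, hdegR, hScard])
  have hprod := Polynomial.C_leadingCoeff_mul_prod_multiset_X_sub_C hcard
  rw [← hSeq, hlc] at hprod
  have h := congrArg (Polynomial.eval t) hprod
  rw [heval] at h
  rw [← h, Polynomial.eval_mul, Polynomial.eval_C, Polynomial.eval_multiset_prod, hS,
    Multiset.map_map, Multiset.map_map, Finset.prod_eq_multiset_prod]
  simp only [Function.comp_def, Polynomial.eval_sub, Polynomial.eval_X, Polynomial.eval_C]

/-- **Parity split of a product over `range (2n)`**: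
`∏_{i < 2n} f i = (∏_{k < n} f (2k)) · ∏_{k < n} f (2k + 1)`. [folklore] -/
theorem engine_prod_range_even_odd : ∀ (f : ℕ → ℝ) (n : ℕ),
    ∏ i ∈ Finset.range (2 * n), f i =
      (∏ k ∈ Finset.range n, f (2 * k)) * ∏ k ∈ Finset.range n, f (2 * k + 1) := by
  intro f n
  induction n with
  | zero => simp
  | succ n ih =>
    rw [show 2 * (n + 1) = 2 * n + 1 + 1 by ring, Finset.prod_range_succ, Finset.prod_range_succ,
      ih, Finset.prod_range_succ, Finset.prod_range_succ]
    ring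

end Summit.KontsevichZagierPeriods.AbelContraction.RealHyperellipticSector

end
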